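import Literature.NumberTheory.Automorphic.BrandtWeightedPairing
import Literature.NumberTheory.Automorphic.BrandtEigenLine
import Literature.NumberTheory.Automorphic.BrandtModuleWeightSymmProofs
import Literature.NumberTheory.Automorphic.DefiniteOrderUnitsFinite
import HarnessLib

/-!
# An integral Hecke multiple of the projector onto a Brandt eigen-line

Topic `NumberTheory/Automorphic`; theorems only (no definition, no named fact, no instance).
Let `ι` be a finite index type, `w : ι → ℕ` positive weights, `N : ℕ`, `T : ℕ → Matrix ι ι ℤ`
integer matrices with `T(p)` `w`-symmetric (`w_i T(p)_ij = w_j T(p)_ji`) for the primes `p ∤ N`,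
`λ : ℕ → ℤ`, and suppose that the eigen-lattice
`L(λ) = {v ∈ ℤ^ι : T(p) v = λ(p) v for all primes p ∤ N}` (`Brandt.eigenLattice`) is a line
`ℤ φ`, `φ ≠ 0`.  Put `ξ = ⟨φ, φ⟩_w = Σ_i w_i φ_i²`
(`Brandt.xi`, Gross's self-pairing; Pollack–Weston's `ξ_f = ⟨g_f, g_f⟩`).  The `w`-orthogonal
projector of `ℚ^ι` onto `ℚ φ` is `π_φ = φ (w φ)ᵀ / ξ`, i.e. `(π_φ)_cd = φ_c w_d φ_d / ξ`.

* `Brandt.exists_heckeProjector` — **there are an integer `D > 0` and a matrix `M` in the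
  `ℤ`-algebra `𝕋` generated by the `T(p)`, `p` prime, `p ∤ N`, with `ξ · M_cd = D · w_d φ_d φ_c`
  for all `c, d`; i.e. `D · π_φ ∈ 𝕋`.**
* `Brandt.XiSetup.exists_heckeProjector`, `Brandt.XiSetup.exists_heckeProjector_xi` — the same
  for the Brandt matrices `B(n)` and the weights `w_c = #O_L(I_c)ˣ / 2` of a Brandt setup `S` of
  type `(N⁺, N⁻)` (definite quaternion algebra over `ℚ` of discriminant `N⁻`, Eichler order of
  level `N⁺`; `BrandtXi.lean`), with `M` in the `ℤ`-algebra generated by all `B(n)`, `n ≥ 1`, and,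
  in the second form, level `N⁺N⁻` and `ξ = S.xi λ`.  The arithmetic inputs are the tree's
  `Brandt.XiSetup.weight_mul_matrix_symm` (Eichler's symmetry `w_i B(n)_ij = w_j B(n)_ji`,
  `BrandtModuleWeightSymmProofs.lean`) and `Brandt.XiSetup.one_le_weight` (`w_c ≥ 1`,
  `DefiniteOrderUnitsFinite.lean`).
* `Brandt.exists_finset_primes_mem_eigenLattice` — finitely many good primes already cut out
  the eigen-lattice.

Context.  The integers `D` with `D · π_φ ∈ 𝕋` form an ideal `(η)` of `ℤ`; when `𝕋` is
commutative, `ℤ / η` is the congruence module `𝕋 / (𝔭_φ + Ann 𝔭_φ)` of the eigen-line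
(`𝔭_φ = ker (𝕋 → ℤ)` its eigencharacter; `Ann 𝔭_φ = 𝕋 ∩ ℚ π_φ` because every element of
`𝕋` is then `w`-self-adjoint) in the sense of Wiles and Diamond (Diamond 1997, with `ℤ` in
place of `𝒪`), while `ξ` measures the lattice-theoretic congruence module `ℤ^ι / (ℤ φ ⊕ φ^⊥)`
of Pollack–Weston 2011 §2.1 (after Ribet and Gross 1987).  This file only proves `η ≠ 0`,
i.e. that SOME positive multiple of `π_φ` is an integral Hecke operator.

Proof of `exists_heckeProjector` (elementary; neither commutativity of the `T(p)` nor
semisimplicity of `𝕋 ⊗ ℚ` is used — weight symmetry and positivity replace them).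
1. Finitely many good primes `P` cut out `L(λ)` (`exists_finset_primes_mem_eigenLattice`:
   minimise the dimension of the rational common eigenspace over finite sets of good primes and
   use `ℤ^ι ∩ L(λ)_ℚ = L(λ)`, `Brandt.intCast_mem_eigenSpace_iff`).
2. `s = Σ_{p ∈ P} (T(p) − λ(p))² ∈ 𝕋` is `w`-symmetric and `⟨s v, v⟩_w = Σ_p ⟨u_p v, u_p v⟩_w`
   (`u_p = T(p) − λ(p)` is `w`-self-adjoint, `Brandt.wpair_mulVec`), so positivity of
   `⟨x, x⟩_w` (`Brandt.eq_zero_of_wpair_self_eq_zero`) gives `ker_ℤ s ⊆ L(λ) = ℤ φ`, `s φ = 0`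
   and `ker s² = ker s`.
3. `μ = minpoly_ℤ(s)` has `μ(0) = 0`; write `μ = X · g`.  If `g(0) = 0`, then `μ = X² r` and
   `s² r(s) = 0` forces `s r(s) = 0`, so `X r` kills `s` — contradicting `minpoly.min`.  Hence
   `g(0) ≠ 0`.
4. `E = g(s) ∈ 𝕋` satisfies `s E = μ(s) = 0`, so every `E v` lies in `ℤ φ`; `E φ = g(0) φ`
   (`Brandt.aeval_mulVec_of_mulVec_eq_zero`); `E` is `w`-symmetric (`Brandt.wsymm_aeval`).
   Pairing `E v = c_v φ` with `φ` gives `⟨φ, φ⟩_w c_v = ⟨v, E φ⟩_w = g(0) ⟨v, φ⟩_w`, whence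
   `ξ · E = g(0) · φ (w φ)ᵀ`.  Take `D = |g(0)|`, `M = sign(g(0)) · E`.

What is NOT here: any bound on `D` or on `η` (its size, in particular its `2`-part, is the
arithmetic question), the comparison of `η` with `ξ`, freeness/Gorenstein properties of the
Brandt module over `𝕋` (Emerton 2002), and the Jacquet–Langlands input that makes `L(λ_f)` a
line for a newform `f`.

## References

* R. Pollack, T. Weston, *On anticyclotomic μ-invariants of modular forms*, Compos. Math. 147
  (2011), §2.1 [PollackWeston2011].
* F. Diamond, *The Taylor–Wiles construction and multiplicity one*, Invent. Math. 128 (1997)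
  [Diamond1997].
* B. H. Gross, *Heights and the special values of L-series*, CMS Conf. Proc. 7 (1987), §§1–4
  [Gross1987].
* M. Emerton, *Supersingular elliptic curves, theta series and weight two modular forms*,
  J. Amer. Math. Soc. 15 (2002) [Emerton2002].
-/

open scoped Matrix
open Polynomial

namespace Literature.NumberTheory.Automorphic

namespace Brandt

variable {ι : Type*} [Fintype ι]

/-! ### Finitely many good primes cut out the eigen-lattice -/

/-- For integer matrices `T p` and an eigenvalue system `λ`, some FINITE set `P` of primes
`p ∤ N` already cuts out the eigen-lattice: every `v ∈ ℤ^ι` with `T(p) v = λ(p) v` for `p ∈ P`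
lies in `eigenLattice N T λ`.  (Minimise the dimension of the rational common eigenspace
`⋂_{p ∈ P} ker (T(p) − λ(p))` over finite sets `P` of good primes; a minimiser is contained in
every further eigenspace, and `ℤ^ι ∩ L(λ)_ℚ = L(λ)`.) [folklore] -/
theorem exists_finset_primes_mem_eigenLattice (N : ℕ) (T : ℕ → Matrix ι ι ℤ) (lam : ℕ → ℤ) :
    ∃ P : Finset ℕ, (∀ p ∈ P, p.Prime ∧ ¬ p ∣ N) ∧
      ∀ v : ι → ℤ, (∀ p ∈ P, T p *ᵥ v = lam p • v) → v ∈ eigenLattice N T lam := by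
  classical
  -- the rational eigenspace of a single prime
  let E : ℕ → Submodule ℚ (ι → ℚ) := fun p =>
    Module.End.eigenspace (Matrix.toLin' ((T p).map (Int.castRingHom ℚ))) (lam p : ℚ)
  let good : Type := {p : ℕ // p.Prime ∧ ¬ p ∣ N}
  -- finite intersections over good primes, and a dimension minimiser
  let K : Finset good → Submodule ℚ (ι → ℚ) := fun P => P.inf fun p => E p.1
  let P₀ : Finset good := Function.argmin fun P => Module.finrank ℚ (K P)
  have hmin : ∀ P, Module.finrank ℚ (K P₀) ≤ Module.finrank ℚ (K P) := fun P =>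
    Function.argmin_le (fun P => Module.finrank ℚ (K P)) P
  have hle : ∀ p : good, K P₀ ≤ E p.1 := by
    intro p
    have h1 : K (insert p P₀) ≤ K P₀ := Finset.inf_mono (Finset.subset_insert _ _)
    have h2 : K (insert p P₀) = K P₀ := Submodule.eq_of_le_of_finrank_le h1 (hmin _)
    have h3 : K (insert p P₀) ≤ E p.1 :=
      Finset.inf_le (f := fun q : good => E q.1) (Finset.mem_insert_self p P₀)
    rwa [h2] at h3
  -- membership of the image of an integer vector in `E p`
  have hcast : ∀ (p : ℕ) (v : ι → ℤ), T p *ᵥ v = lam p • v → (fun i => (v i : ℚ)) ∈ E p := by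
    intro p v hv
    rw [Module.End.mem_eigenspace_iff, Matrix.toLin'_apply]
    funext i
    have h := (RingHom.map_mulVec (Int.castRingHom ℚ) (T p) v i).symm
    rw [show ((Int.castRingHom ℚ) ∘ v) = fun i => (v i : ℚ) from rfl] at h
    rw [h, hv]
    simp
  refine ⟨P₀.image fun p => p.1, ?_, ?_⟩
  · intro p hp
    obtain ⟨q, -, rfl⟩ := Finset.mem_image.mp hp
    exact q.2
  · intro v hv
    have hvK : (fun i => (v i : ℚ)) ∈ K P₀ := by
      rw [Submodule.mem_finsetInf]
      intro q hq
      exact hcast q.1 v (hv q.1 (Finset.mem_image_of_mem _ hq))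
    rw [← intCast_mem_eigenSpace_iff (K := ℚ), mem_eigenSpace_iff]
    intro p hp hpN
    have h := hle ⟨p, hp, hpN⟩ hvK
    rw [Module.End.mem_eigenspace_iff, Matrix.toLin'_apply] at h
    exact h

/-! ### The integral Hecke projector -/

/-- **An integral Hecke multiple of the projector onto an eigen-line exists.**  Let the
matrices `T(p)`, `p` prime, `p ∤ N`, be `w`-symmetric (`w_i T(p)_ij = w_j T(p)_ji`) for positive
weights `w`, and let the eigen-lattice of `λ` (primes `p ∤ N`) be a line `ℤ φ`, `φ ≠ 0`.  Then
there are `D > 0` and `M` in the `ℤ`-algebra generated by the `T(p)`, `p` prime, `p ∤ N`, with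
`ξ · M_cd = D · w_d φ_d φ_c` for all `c, d`, where `ξ = xi w (ℤ φ) = Σ_i w_i φ_i²`; that is,
`M = D · π_φ` for the `w`-orthogonal projector `π_φ = φ (w φ)ᵀ / ξ` onto `ℚ φ`.  (`M = ± g(s)`
with `s = Σ_{p ∈ P} (T(p) − λ(p))²`, `P` as in `exists_finset_primes_mem_eigenLattice`,
`minpoly_ℤ(s) = X · g`, `D = |g(0)|`; see the module docstring.)  The least such `D` generates
the ideal of all of them — the congruence exponent of the line in the integral Hecke ring
(Diamond 1997; Pollack–Weston 2011 §2.1 for the definite quaternionic setting). [folklore] -/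
theorem exists_heckeProjector [DecidableEq ι] (w : ι → ℕ) (hw : ∀ i, 0 < w i) (N : ℕ)
    (T : ℕ → Matrix ι ι ℤ)
    (hT : ∀ p : ℕ, p.Prime → ¬ p ∣ N → ∀ i j, (w i : ℤ) * T p i j = (w j : ℤ) * T p j i)
    (lam : ℕ → ℤ) {φ : ι → ℤ} (hφ : φ ≠ 0) (hL : eigenLattice N T lam = ℤ ∙ φ) :
    ∃ D : ℕ, 0 < D ∧
      ∃ M ∈ Algebra.adjoin ℤ {X : Matrix ι ι ℤ | ∃ p : ℕ, p.Prime ∧ ¬ p ∣ N ∧ X = T p},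
        ∀ c d : ι, (xi w (eigenLattice N T lam) : ℤ) * M c d =
          (D : ℤ) * (w d : ℤ) * φ d * φ c := by
  have hφL : φ ∈ eigenLattice N T lam := by
    rw [hL]; exact Submodule.mem_span_singleton_self φ
  -- Step 1: finitely many good primes cut out the line
  obtain ⟨P, hP, hPker⟩ := exists_finset_primes_mem_eigenLattice N T lam
  -- the Hecke algebra of the good primes and the operator `s = Σ_{p ∈ P} (T p - λ p)²`
  set A : Subalgebra ℤ (Matrix ι ι ℤ) :=
    Algebra.adjoin ℤ {X : Matrix ι ι ℤ | ∃ p : ℕ, p.Prime ∧ ¬ p ∣ N ∧ X = T p} with hA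
  set u : ℕ → Matrix ι ι ℤ := fun p => T p - lam p • (1 : Matrix ι ι ℤ) with hu
  set s : Matrix ι ι ℤ := ∑ p ∈ P, u p * u p with hs
  have huA : ∀ p ∈ P, u p ∈ A := fun p hp =>
    A.sub_mem (Algebra.subset_adjoin ⟨p, (hP p hp).1, (hP p hp).2, rfl⟩)
      (A.smul_mem A.one_mem _)
  have hsA : s ∈ A := A.sum_mem fun p hp => A.mul_mem (huA p hp) (huA p hp)
  have husymm : ∀ p ∈ P, ∀ i j, (w i : ℤ) * u p i j = (w j : ℤ) * u p j i := fun p hp =>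
    wsymm_sub (hT p (hP p hp).1 (hP p hp).2) (wsymm_smul (wsymm_one w) _)
  have hssymm : ∀ i j, (w i : ℤ) * s i j = (w j : ℤ) * s j i :=
    wsymm_sum fun p hp => wsymm_mul_of_commute (husymm p hp) (husymm p hp) rfl
  have hu_mulVec : ∀ p v, u p *ᵥ v = T p *ᵥ v - lam p • v := fun p v => by
    simp only [hu, Matrix.sub_mulVec, Matrix.smul_mulVec, Matrix.one_mulVec]
  -- Step 2: the integer kernel of `s` is the line, and `ker s² = ker s`
  have hker : ∀ v : ι → ℤ, s *ᵥ v = 0 → v ∈ eigenLattice N T lam := by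
    intro v hv
    refine hPker v fun p hp => ?_
    have hsum : ∑ i, (w i : ℤ) * (s *ᵥ v) i * v i =
        ∑ q ∈ P, ∑ i, (w i : ℤ) * (u q *ᵥ v) i * (u q *ᵥ v) i := by
      rw [hs, Matrix.sum_mulVec, wpair_sum_left]
      refine Finset.sum_congr rfl fun q hq => ?_
      rw [← Matrix.mulVec_mulVec, wpair_mulVec w (husymm q hq)]
    have h0 : ∑ q ∈ P, ∑ i, (w i : ℤ) * (u q *ᵥ v) i * (u q *ᵥ v) i = 0 := by
      rw [← hsum, hv, wpair_zero_left]
    have hq := (Finset.sum_eq_zero_iff_of_nonneg fun q _ => wpair_self_nonneg w (u q *ᵥ v)).mp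
      h0 p hp
    have h := eq_zero_of_wpair_self_eq_zero hw hq
    rwa [hu_mulVec, sub_eq_zero] at h
  have hsφ : s *ᵥ φ = 0 := by
    rw [hs, Matrix.sum_mulVec]
    refine Finset.sum_eq_zero fun p hp => ?_
    have h : u p *ᵥ φ = 0 := by
      rw [hu_mulVec, sub_eq_zero]; exact hφL p (hP p hp).1 (hP p hp).2
    rw [← Matrix.mulVec_mulVec, h, Matrix.mulVec_zero]
  have hker2 : ∀ v : ι → ℤ, s *ᵥ (s *ᵥ v) = 0 → s *ᵥ v = 0 := fun v hv =>
    eq_zero_of_wpair_self_eq_zero hw (by rw [← wpair_mulVec w hssymm, hv, wpair_zero_left])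
  -- Step 3: the minimal polynomial `μ = X · g` of `s`, with `g(0) ≠ 0`
  haveI : Nonempty ι := by
    by_contra h
    exact hφ (funext fun i => (h ⟨i⟩).elim)
  have hint : IsIntegral ℤ s := Matrix.isIntegral s
  set μ : ℤ[X] := minpoly ℤ s with hμ
  have hμmonic : μ.Monic := minpoly.monic hint
  have hμ0 : aeval s μ = 0 := minpoly.aeval ℤ s
  have hμcoeff : μ.coeff 0 = 0 := by
    have h := aeval_mulVec_of_mulVec_eq_zero s μ hsφ
    rw [hμ0, Matrix.zero_mulVec] at h
    exact (smul_eq_zero.mp h.symm).resolve_right hφ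
  set g : ℤ[X] := μ.divX with hg
  have hμg : g * X = μ := by
    have h := μ.divX_mul_X_add
    rwa [hμcoeff, map_zero, add_zero] at h
  have hgmonic : g.Monic := Monic.of_mul_monic_right monic_X (hμg ▸ hμmonic)
  have hg0 : g.coeff 0 ≠ 0 := by
    intro hg0
    set r : ℤ[X] := g.divX with hr
    have hgr : r * X = g := by
      have h := g.divX_mul_X_add
      rwa [hg0, map_zero, add_zero] at h
    have hrmonic : r.Monic := Monic.of_mul_monic_right monic_X (hgr ▸ hgmonic)
    -- `s² r(s) = μ(s) = 0`, hence `s r(s) = 0` because `ker s² = ker s`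
    have h1 : s * (s * aeval s r) = 0 := by
      rw [← hμ0, ← hμg, ← hgr, show r * X * X = X * (X * r) by ring, map_mul, map_mul, aeval_X]
    have h2 : s * aeval s r = 0 := by
      refine Matrix.ext_iff_mulVec.mpr fun v => ?_
      rw [Matrix.zero_mulVec, ← Matrix.mulVec_mulVec]
      refine hker2 _ ?_
      rw [Matrix.mulVec_mulVec, Matrix.mulVec_mulVec, mul_assoc, h1, Matrix.zero_mulVec]
    have h3 : aeval s (X * r) = 0 := by rw [map_mul, aeval_X, h2]
    -- contradiction with the minimality of `μ`
    have hmin := natDegree_le_natDegree (minpoly.min ℤ s (monic_X.mul hrmonic) h3)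
    have hr0 : r ≠ 0 := hrmonic.ne_zero
    have hdeg1 : (X * r).natDegree = r.natDegree + 1 := by
      rw [natDegree_mul X_ne_zero hr0, natDegree_X, add_comm]
    have hdeg2 : μ.natDegree = r.natDegree + 2 := by
      rw [← hμg, ← hgr, natDegree_mul (mul_ne_zero hr0 X_ne_zero) X_ne_zero,
        natDegree_mul hr0 X_ne_zero, natDegree_X]
    rw [← hμ, hdeg1, hdeg2] at hmin
    omega
  -- Step 4: the projector `E = g(s)`
  set E : Matrix ι ι ℤ := aeval s g with hE
  have hEA : E ∈ A :=
    (Algebra.adjoin_le (Set.singleton_subset_iff.mpr hsA) : Algebra.adjoin ℤ {s} ≤ A)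
      (aeval_mem_adjoin_singleton ℤ s)
  have hsE : s * E = 0 := by
    have h : aeval s (X * g) = s * E := by rw [map_mul, aeval_X]
    rw [← h, mul_comm X g, hμg]
    exact hμ0
  have hEsymm : ∀ i j, (w i : ℤ) * E i j = (w j : ℤ) * E j i := wsymm_aeval hssymm g
  have hEφ : E *ᵥ φ = g.coeff 0 • φ := aeval_mulVec_of_mulVec_eq_zero s g hsφ
  have hEline : ∀ v, ∃ c : ℤ, c • φ = E *ᵥ v := fun v => by
    have h : E *ᵥ v ∈ eigenLattice N T lam :=
      hker _ (by rw [Matrix.mulVec_mulVec, hsE, Matrix.zero_mulVec])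
    rw [hL] at h
    exact Submodule.mem_span_singleton.mp h
  -- the key identity `⟪φ, φ⟫_w · E v = g(0) ⟪v, φ⟫_w · φ`
  have hkey : ∀ v, (∑ i, (w i : ℤ) * φ i * φ i) • (E *ᵥ v) =
      (g.coeff 0 * ∑ i, (w i : ℤ) * v i * φ i) • φ := fun v => by
    obtain ⟨c, hc⟩ := hEline v
    have h1 : ∑ i, (w i : ℤ) * (E *ᵥ v) i * φ i = c * ∑ i, (w i : ℤ) * φ i * φ i := by
      rw [← hc, wpair_smul_left]
    have h2 : ∑ i, (w i : ℤ) * (E *ᵥ v) i * φ i = g.coeff 0 * ∑ i, (w i : ℤ) * v i * φ i := by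
      rw [wpair_mulVec w hEsymm, hEφ, wpair_smul_right]
    rw [← hc, smul_smul, mul_comm, ← h1, h2]
  -- entries: `⟪φ, φ⟫_w · E_cd = g(0) w_d φ_d φ_c`
  have hentry : ∀ c d, (∑ i, (w i : ℤ) * φ i * φ i) * E c d =
      g.coeff 0 * (w d : ℤ) * φ d * φ c := fun c d => by
    have h := congrFun (hkey (Pi.single d 1)) c
    rw [Matrix.mulVec_single_one, wpair_single_left] at h
    simp only [Pi.smul_apply, smul_eq_mul, Matrix.col_apply] at h
    rw [h]; ring
  -- `ξ = ⟪φ, φ⟫_w`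
  have hxi : (xi w (eigenLattice N T lam) : ℤ) = ∑ i, (w i : ℤ) * φ i * φ i := by
    rw [xi_eq_sum w hφ hL]
    push_cast
    refine Finset.sum_congr rfl fun i _ => ?_
    rw [sq_abs]; ring
  refine ⟨(g.coeff 0).natAbs, Int.natAbs_pos.mpr hg0, (g.coeff 0).sign • E, A.smul_mem hEA _,
    fun c d => ?_⟩
  rw [hxi, Matrix.smul_apply, smul_eq_mul, mul_left_comm, hentry, ← Int.sign_mul_self_eq_natAbs]
  ring

/-! ### Brandt setups -/

open scoped Classical in
/-- **Setup form.**  In a Brandt setup `S` of type `(N⁺, N⁻)` — weights `w_c = #O_L(I_c)ˣ / 2 ≥ 1`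
(`Brandt.XiSetup.one_le_weight`), Brandt matrices `w`-symmetric
(`Brandt.XiSetup.weight_mul_matrix_symm`) — if the eigen-lattice of `λ` at level `N` is a line
`ℤ φ`, `φ ≠ 0`, then some positive multiple `D · π_φ` of the `w`-orthogonal projector onto `ℚ φ`
lies in the `ℤ`-algebra generated by all Brandt matrices `B(n)`, `n ≥ 1`:
`ξ · M_cd = D · w_d φ_d φ_c` with `ξ = xi w L(λ) = Σ_c w_c φ_c²`. [cite: PollackWeston2011, §2.1] -/
theorem XiSetup.exists_heckeProjector {Nplus Nminus : ℕ} (S : XiSetup Nplus Nminus)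
    [Fintype (ClassSet S.O)] (N : ℕ) (lam : ℕ → ℤ) {φ : ClassSet S.O → ℤ} (hφ : φ ≠ 0)
    (hL : eigenLattice N (Brandt.matrix S.O) lam = ℤ ∙ φ) :
    ∃ D : ℕ, 0 < D ∧
      ∃ M ∈ Algebra.adjoin ℤ (Set.range fun n : ℕ => Brandt.matrix S.O (n + 1)),
        ∀ c d : ClassSet S.O,
          (Brandt.xi (weight S.O) (eigenLattice N (Brandt.matrix S.O) lam) : ℤ) * M c d =
            (D : ℤ) * (weight S.O d : ℤ) * φ d * φ c := by
  obtain ⟨D, hD, M, hM, hMcd⟩ := Brandt.exists_heckeProjector (weight S.O)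
    (fun c => S.one_le_weight c) N (Brandt.matrix S.O)
    (fun p _ _ i j => S.weight_mul_matrix_symm p i j) lam hφ hL
  refine ⟨D, hD, M, Algebra.adjoin_mono ?_ hM, hMcd⟩
  rintro X ⟨p, hp, -, rfl⟩
  refine ⟨p - 1, ?_⟩
  dsimp only
  rw [Nat.sub_add_cancel hp.one_le]

open scoped Classical in
/-- **Setup form at level `N⁺N⁻`, with `ξ = S.xi λ`.**  For a Brandt setup `S` of type
`(N⁺, N⁻)` and a generator `φ` of the `λ`-eigen-line of the Brandt matrices (primes `p ∤ N⁺N⁻`)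
there are `D > 0` and `M ∈ ℤ[B(n) : n ≥ 1]` with `S.xi λ · M_cd = D · w_d φ_d φ_c` for all
classes `c, d`: an integral Hecke operator `M = D · π_φ`.  The least such `D` is the congruence
exponent of `φ` in the integral Brandt–Hecke ring. [cite: PollackWeston2011, §2.1] -/
theorem XiSetup.exists_heckeProjector_xi {Nplus Nminus : ℕ} (S : XiSetup Nplus Nminus)
    [Fintype (ClassSet S.O)] (lam : ℕ → ℤ) (φ : ClassSet S.O → ℤ) (hφ : φ ≠ 0)
    (hL : eigenLattice (Nplus * Nminus) (Brandt.matrix S.O) lam = ℤ ∙ φ) :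
    ∃ D : ℕ, 0 < D ∧
      ∃ M ∈ Algebra.adjoin ℤ (Set.range fun n : ℕ => Brandt.matrix S.O (n + 1)),
        ∀ c d : ClassSet S.O,
          (S.xi lam : ℤ) * M c d = (D : ℤ) * (weight S.O d : ℤ) * φ d * φ c := by
  rw [XiSetup.xi, xiOfOrder_eq]
  exact XiSetup.exists_heckeProjector S _ lam hφ hL

end Brandt

end Literature.NumberTheory.Automorphic
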